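import Summits.NavierStokesRegularity.NavierStokesRegularity.Theorems.AxisymmetricExtremalityAxisymmetricKatoGlobalStubSeregin2020TypeIILemma22VeryWeakAcrossS
import Summits.NavierStokesRegularity.NavierStokesRegularity.Theorems.AxisymmetricExtremalityAxisymmetricKatoGlobalStubSeregin2020TypeIILemma22AxisTestFunction
import Summits.NavierStokesRegularity.NavierStokesRegularity.Theorems.AxisymmetricExtremalityAxisymmetricKatoGlobalStubSeregin2020TypeIILemma22AxisMeasurePrep
import HarnessLib

/-!
# Seregin 2020, Lemma 2.2 (after Nazarov–Uraltseva 2012): the measure estimate (4.6)–(4.8) —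
# a lower bound on the axis propagates to a superlevel set of positive measure

Helper toward the stub `stub_seregin2020TypeII` of the crux `AxisymmetricKatoGlobal` (= the named
fact `Literature.Analysis.FluidPDE.Seregin2020_axisymmetricSingularPoint_typeII`, G. Seregin,
Anal. Math. Phys. 10 (2020) Paper 46 = arXiv:2006.04140, Thm 2.1), reduced in the tree to the
corrected Lemma 2.2 (`hWH′`; Nazarov–Uraltseva 2012, Lemma 4.2 for the class 𝒱). This file is
piece L22-A of the cell's cut (Cruxes/AxisymmetricKatoGlobal/Lemma22Skeleton.lean): the FIRST HALF
of the proof of N–U Lemma 4.2 — "we claim that `meas(Ê_ϰ) ≥ δ meas(Q_R^{1,¼})` for some `ϰ, δ > 0`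
depending only on `q, ℓ, 𝔑, 𝒩̂`" ((4.8)), obtained by testing the very weak form (4.5) (here: the
class-𝒱 form across `S`, `veryWeak_supersolution_axis_acrossS`) with the cut-off of (4.6)
(`…Lemma22AxisTestFunction`) and splitting at the level `ϰk` ((4.7)). In place of N–U's Hölder
bounds `‖1‖_{q',ℓ',Ê}`, `‖1‖_{9/4,1,Ê}` the truncation bounds of `…Lemma22AxisMeasureTools` are
used (same scaling); constants, slab facts and the bookkeeping are in `…Lemma22AxisMeasurePrep`.
Output in the shape of the measure hypothesis of the registered `lemma22_expansionOfPositivity`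
(with `κ = ϰk ≤ k`):

* `axis_measure_estimate` — for every `M` and `N` there are `ϰ ∈ ]0,1]`, `δ > 0` such that for
  the class-𝒱 data of `hWH′` at scale `R` with `Φ ≥ k` on the regular axis of
  `B(2R) × ]-R²,0[`, `Φ ≤ Mk` there and drift bound `N`:
  `δ R⁵ ≤ |{z ∈ [-R², -¾R²] × B_R : Φ(z) > ϰk}|`.

No NS regularity statement is proved here; a printed lemma is being re-proved.

## References

* A. I. Nazarov, N. N. Uraltseva, St. Petersburg Math. J. 23 (2012) 93–115 = arXiv:1011.1888,
  proof of Lemma 4.2, (4.6)–(4.8). [NazarovUraltseva2012]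
* G. Seregin, Anal. Math. Phys. 10 (2020), Paper 46 = arXiv:2006.04140, Lemma 2.2 (2.13)–(2.15)
  (arXiv p. 8). [Seregin2020]
-/

-- the problem directory repeats the summit name (D-0017); core's `dupNamespace` linter fires
set_option linter.dupNamespace false

noncomputable section

open MeasureTheory Set Function Filter Topology TopologicalSpace Metric
open scoped NNReal ENNReal InnerProductSpace Laplacian

namespace Summit.NavierStokesRegularity.NavierStokesRegularity.Theorems.AxisymmetricKatoGlobal.EulerScaling

open Literature.Analysis.FluidPDE Literature.Analysis.FluidPDE.Seregin2020
  Literature.Analysis.FluidPDE.SereginZajaczkowski2007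

/-- **N–U 2012, Lemma 4.2, (4.6)–(4.8): the measure estimate** (piece L22-A of Seregin's
Lemma 2.2 in the class 𝒱). For all `M` and `N` there are `ϰ ∈ ]0, 1]` and `δ > 0` (depending on
`M, N` only) such that: for the data `(U, Φ, S)` of `hWH′` (drift `U` continuous with smooth
divergence-free slices off the axis and locally `L³`; `S` closed, on the axis, `𝒫¹`-null; `Φ` of
class 𝒱 off `S`, `0 ≤ Φ ≤ B`, SUPERsolution of (2.12) off the axis) at scale `R` with the drift
bound `∫_{-R²}^0 (∫_{B(2R)} ‖U‖³)^{4/3} ≤ N R²`, (2.13) `Φ ≥ k` at the regular axis points of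
`B(2R) × ]-R², 0[`, and (2.14) `Φ ≤ Mk` there, the superlevel set `{Φ > ϰk}` has measure at least
`δ R⁵` inside `[-R², -¾R²] × B_R`. [cite: NazarovUraltseva2012, proof of Lemma 4.2, (4.6)–(4.8); Seregin2020, Lemma 2.2] -/
theorem axis_measure_estimate : ∀ (M : ℝ) (N : ℝ≥0), ∃ ϰ δ : ℝ, 0 < ϰ ∧ ϰ ≤ 1 ∧ 0 < δ ∧
    ∀ (U : ℝ → EuclideanSpace ℝ (Fin 3) → EuclideanSpace ℝ (Fin 3)) (Φ : ℝ → EuclideanSpace ℝ (Fin 3) → ℝ)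
      (S : Set (ℝ × EuclideanSpace ℝ (Fin 3))) (R k : ℝ),
    ContinuousOn (uncurry U) {z : ℝ × EuclideanSpace ℝ (Fin 3) | z.1 < 0 ∧ cylRadius z.2 ≠ 0} →
    (∀ z : ℝ × EuclideanSpace ℝ (Fin 3), z.1 < 0 → cylRadius z.2 ≠ 0 → ContDiffAt ℝ (⊤ : ℕ∞) (U z.1) z.2) →
    (∀ z : ℝ × EuclideanSpace ℝ (Fin 3), z.1 < 0 → cylRadius z.2 ≠ 0 → VectorCalculus.divergence (U z.1) z.2 = 0) →
    (∀ a : ℝ, 0 < a → ∫⁻ z in parabolicCylinder a (0 : ℝ × EuclideanSpace ℝ (Fin 3)), ‖U z.1 z.2‖ₑ ^ (3 : ℕ) < ∞) →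
    IsClosed S → (∀ z ∈ S, z.1 ≤ 0 ∧ cylRadius z.2 = 0) → IsParabolicNull 1 S →
    ContinuousOn (uncurry Φ) ({z : ℝ × EuclideanSpace ℝ (Fin 3) | z.1 < 0} \ S) →
    (∀ z : ℝ × EuclideanSpace ℝ (Fin 3), z.1 < 0 → z ∉ S → ContDiffAt ℝ (⊤ : ℕ∞) (Φ z.1) z.2) →
    ContinuousOn (fun z : ℝ × EuclideanSpace ℝ (Fin 3) => fderiv ℝ (Φ z.1) z.2)
      ({z : ℝ × EuclideanSpace ℝ (Fin 3) | z.1 < 0} \ S) →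
    (∀ e : EuclideanSpace ℝ (Fin 3), ContinuousOn
      (fun z : ℝ × EuclideanSpace ℝ (Fin 3) => fderiv ℝ (fun y => fderiv ℝ (Φ z.1) y e) z.2 e)
      ({z : ℝ × EuclideanSpace ℝ (Fin 3) | z.1 < 0} \ S)) →
    (∀ z : ℝ × EuclideanSpace ℝ (Fin 3), z.1 < 0 → cylRadius z.2 ≠ 0 → DifferentiableAt ℝ (fun r => Φ r z.2) z.1) →
    ContinuousOn (fun z : ℝ × EuclideanSpace ℝ (Fin 3) => deriv (fun r => Φ r z.2) z.1)
      {z : ℝ × EuclideanSpace ℝ (Fin 3) | z.1 < 0 ∧ cylRadius z.2 ≠ 0} →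
    (∃ B : ℝ, ∀ z : ℝ × EuclideanSpace ℝ (Fin 3), z.1 < 0 → z ∉ S → |Φ z.1 z.2| ≤ B) →
    (∀ z : ℝ × EuclideanSpace ℝ (Fin 3), z.1 < 0 → z ∉ S → 0 ≤ Φ z.1 z.2) →
    (∀ z : ℝ × EuclideanSpace ℝ (Fin 3), z.1 < 0 → cylRadius z.2 ≠ 0 →
      0 ≤ deriv (fun r => Φ r z.2) z.1 + fderiv ℝ (Φ z.1) z.2 (U z.1 z.2) +
          2 / cylRadius z.2 * partialDeriv (eR z.2) (Φ z.1) z.2 - (Δ (Φ z.1)) z.2) →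
    0 < R → 0 < k → 1 ≤ M →
    (∫⁻ s in Ioo (-R ^ 2) 0, (∫⁻ y in ball (0 : EuclideanSpace ℝ (Fin 3)) (2 * R), ‖U s y‖ₑ ^ (3 : ℕ)) ^ (4 / 3 : ℝ) ≤
      (N : ℝ≥0∞) * ENNReal.ofReal R ^ 2) →
    (∀ z : ℝ × EuclideanSpace ℝ (Fin 3), z.1 ∈ Ioo (-R ^ 2) 0 → cylRadius z.2 = 0 →
      z.2 2 ∈ Ioo (-(2 * R)) (2 * R) → z ∉ S → k ≤ Φ z.1 z.2) →
    (∀ z : ℝ × EuclideanSpace ℝ (Fin 3), z.1 ∈ Ioo (-R ^ 2) 0 → z.2 ∈ ball (0 : EuclideanSpace ℝ (Fin 3)) (2 * R) →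
      z ∉ S → Φ z.1 z.2 ≤ M * k) →
    ENNReal.ofReal (δ * R ^ 5) ≤
      volume {z : ℝ × EuclideanSpace ℝ (Fin 3) | z ∈ Icc (-R ^ 2) (-(3 / 4) * R ^ 2) ×ˢ ball (0 : EuclideanSpace ℝ (Fin 3)) R ∧
        ϰ * k < Φ z.1 z.2} := by
  intro M N
  classical
  /- ── the constants ── -/
  obtain ⟨C₀, hC₀0, hC₀⟩ := exists_axisTest_deriv_bounds
  obtain ⟨C32, hC32⟩ := lintegral_inv_cylRadius_rpow_ball_le (3 / 2) (by norm_num) (by norm_num)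
  obtain ⟨M', cN, ℓ, θ, D, ϰ, Γ, δ, hMM', hM'1, hcN, hℓ0, hθ0, hϰ0, hϰ1, hδ0, hΓ, hδ, hP1, hP2, hP3, hD'⟩ :=
    axis_constants M N C32 hC₀0
  refine ⟨ϰ, δ, hϰ0, hϰ1, hδ0, ?_⟩
  intro U Φ S R k hUc hUs hdiv hU3loc hS hSax hSnull hΦc hΦs hΦg hΦ2 hΦt hΦt' hB hpos hsup hR hk hM hN hax hup
  /- ── the slab `Q' = ]-R², -¾R²[ × B_R` ── -/
  obtain ⟨Q', hQ'⟩ : ∃ Q' : Set (ℝ × EuclideanSpace ℝ (Fin 3)),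
      Q' = Ioo (-R ^ 2) (-(3 / 4) * R ^ 2) ×ˢ ball (0 : EuclideanSpace ℝ (Fin 3)) R := ⟨_, rfl⟩
  obtain ⟨K', hK'⟩ : ∃ K' : Set (ℝ × EuclideanSpace ℝ (Fin 3)),
      K' = Icc (-R ^ 2) (-(3 / 4) * R ^ 2) ×ˢ closedBall (0 : EuclideanSpace ℝ (Fin 3)) R := ⟨_, rfl⟩
  have hgeo := slab_geometry hR
  rw [← hQ', ← hK'] at hgeo
  obtain ⟨hQ'o, hQ'K', hK'neg, hQ'neg, hQ'cyl, hQ'fin, hvolQ'r, hboxQ'⟩ := hgeo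
  have hQ'm : MeasurableSet Q' := hQ'o.measurableSet
  have hsi := slab_integrability (R := R) hR hUc hU3loc
  rw [← hQ'] at hsi
  obtain ⟨hUmQ, hU3Q, hU1Q, hρQ⟩ := hsi
  /- ── the test function of (4.6) and the very weak inequality across `S` ── -/
  obtain ⟨η₀, hη₀⟩ : ∃ η₀ : ℝ → EuclideanSpace ℝ (Fin 3) → ℝ,
      ∀ t x, η₀ t x = cutoff (R ^ 2 / 32) (t + 7 * R ^ 2 / 8) * cutoff (3 * R / 8) x := ⟨_, fun _ _ => rfl⟩
  obtain ⟨htest, hη₀0, -, -, htsupp⟩ := axisTest_props hR hη₀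
  have hd := hC₀ R hR η₀ hη₀
  have hKQ' : tsupport (uncurry η₀) ⊆ Q' := htsupp.trans hboxQ'
  have hU3K : ∫⁻ w in tsupport (uncurry η₀), ‖U w.1 w.2‖ₑ ^ (3 : ℕ) < ∞ :=
    lt_of_le_of_lt (lintegral_mono_set (hKQ'.trans hQ'cyl)) (hU3loc (2 * R) (mul_pos two_pos hR))
  have hSax' : ∀ w ∈ S, cylRadius w.2 = 0 := fun w hw => (hSax w hw).2
  have hax' : ∀ w ∈ tsupport (uncurry η₀), cylRadius w.2 = 0 → w ∉ S → k ≤ Φ w.1 w.2 := by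
    intro w hw hρ hwS
    have hwQ := hQ'neg w (hKQ' hw)
    refine hax w hwQ.1 hρ ?_ hwS
    have h3 : |w.2 2| ≤ ‖w.2‖ := abs_apply_le_norm_fin3 _ 2
    have hn : ‖w.2‖ < 2 * R := by simpa [dist_zero_right] using hwQ.2
    rw [mem_Ioo]; constructor <;> linarith [le_abs_self (w.2 2), neg_abs_le (w.2 2)]
  obtain ⟨hineq, hint⟩ := veryWeak_supersolution_axis_acrossS Φ U S hS hSax' hSnull hΦc hΦs hΦg hΦ2 hΦt hΦt' hB hpos
    hUc hUs hdiv hsup η₀ htest hη₀0 hU3K k hk hax'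
  have hlow : 3 * Real.pi / 16 * (k * R ^ 3) ≤ 4 * Real.pi * k * ∫ q : ℝ × ℝ, η₀ q.1 (meridianPoint (0, q.2)) := by
    have h := mul_le_mul_of_nonneg_left (axisTest_axis_integral_ge hR hη₀)
      (mul_nonneg (mul_nonneg (by norm_num : (0:ℝ) ≤ 4) Real.pi_pos.le) hk.le)
    linarith
  /- ── the superlevel set `E` and the majorant `1_{Q'} χ F`, `χ = Mk 1_E + ϰk` ── -/
  obtain ⟨E, hE⟩ : ∃ E : Set (ℝ × EuclideanSpace ℝ (Fin 3)), E = (Q' \ S) ∩ (uncurry Φ) ⁻¹' Ioi (ϰ * k) := ⟨_, rfl⟩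
  have hEo : IsOpen E := by
    rw [hE]
    exact (hΦc.mono (fun w hw => ⟨hK'neg (hQ'K' hw.1), hw.2⟩)).isOpen_inter_preimage (hQ'o.sdiff hS) isOpen_Ioi
  have hEm : MeasurableSet E := hEo.measurableSet
  have hEQ : E ⊆ Q' := fun w hw => by rw [hE] at hw; exact hw.1.1
  have hEfin : volume E < ∞ := (measure_mono hEQ).trans_lt hQ'fin
  obtain ⟨V, hV⟩ : ∃ V : ℝ, V = volume.real E := ⟨_, rfl⟩
  have hV0 : 0 ≤ V := by rw [hV]; exact measureReal_nonneg
  obtain ⟨F, hF⟩ : ∃ F : ℝ × EuclideanSpace ℝ (Fin 3) → ℝ, F = fun w =>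
      2 * C₀ / R ^ 2 + C₀ / R * ‖U w.1 w.2‖ + 2 * C₀ / R * (cylRadius w.2)⁻¹ := ⟨_, rfl⟩
  have hC₀R : 0 ≤ C₀ / R := div_nonneg hC₀0 hR.le
  have h2C₀R : 0 ≤ 2 * C₀ / R := div_nonneg (mul_nonneg two_pos.le hC₀0) hR.le
  have hF0 : ∀ w, 0 ≤ F w := fun w => by
    rw [hF]
    exact add_nonneg (add_nonneg (div_nonneg (mul_nonneg two_pos.le hC₀0) (sq_nonneg R))
      (mul_nonneg hC₀R (norm_nonneg _))) (mul_nonneg h2C₀R (inv_nonneg.2 (cylRadius_nonneg _)))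
  have hFi : IntegrableOn F Q' := by
    have h12 : IntegrableOn (fun w : ℝ × EuclideanSpace ℝ (Fin 3) => 2 * C₀ / R ^ 2 + C₀ / R * ‖U w.1 w.2‖) Q' :=
      (integrableOn_const (C := 2 * C₀ / R ^ 2) hQ'fin.ne).add (hU1Q.const_mul _)
    rw [hF]; exact h12.add (hρQ.const_mul _)
  obtain ⟨χ, hχ⟩ : ∃ χ : ℝ × EuclideanSpace ℝ (Fin 3) → ℝ,
      χ = fun w => M * k * E.indicator (fun _ => (1 : ℝ)) w + ϰ * k := ⟨_, rfl⟩
  have hMk : 0 ≤ M * k := mul_nonneg (by linarith) hk.le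
  have hχm : AEStronglyMeasurable χ (volume.restrict Q') := by
    rw [hχ]; exact ((aestronglyMeasurable_const.indicator hEm).const_mul _).add aestronglyMeasurable_const
  have hχ0 : ∀ w, 0 ≤ χ w := fun w => by
    rw [hχ]; exact add_nonneg (mul_nonneg hMk (indicator_nonneg (fun _ _ => zero_le_one) _)) (mul_nonneg hϰ0.le hk.le)
  have hχbd : ∀ w, ‖χ w‖ ≤ M * k + ϰ * k := fun w => by
    rw [Real.norm_eq_abs, abs_of_nonneg (hχ0 w), hχ]
    have h1 : E.indicator (fun _ => (1 : ℝ)) w ≤ 1 := indicator_le_self' (fun _ _ => zero_le_one) w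
    have h2 := mul_le_mul_of_nonneg_left h1 hMk
    linarith
  have hgi : IntegrableOn (fun w => χ w * F w) Q' := hFi.bdd_mul hχm (Eventually.of_forall hχbd)
  have haeS : ∀ᵐ w : ℝ × EuclideanSpace ℝ (Fin 3), w ∉ S :=
    measure_eq_zero_iff_ae_notMem.1 (measure_mono_null (fun w hw => hSax' w hw) volume_setOf_cylRadius_snd_eq_zero)
  -- the pointwise bound (4.7): `Φ w₀ ≤ 1_{Q'} χ F` a.e.
  have hpt : ∀ᵐ w : ℝ × EuclideanSpace ℝ (Fin 3),
      Φ w.1 w.2 * (|deriv (fun s => η₀ s w.2) w.1| + ‖U w.1 w.2‖ * ‖fderiv ℝ (η₀ w.1) w.2‖ +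
        2 / cylRadius w.2 * ‖fderiv ℝ (η₀ w.1) w.2‖ + |(Δ (η₀ w.1)) w.2|) ≤ Q'.indicator (fun w => χ w * F w) w := by
    filter_upwards [haeS] with w hwS
    by_cases hw : w ∈ tsupport (uncurry η₀)
    · have hwQ : w ∈ Q' := hKQ' hw
      obtain ⟨hwt, hwx⟩ := hQ'neg w hwQ
      have hΦ0 : 0 ≤ Φ w.1 w.2 := hpos w hwt.2 hwS
      obtain ⟨h1, h2, h3⟩ := hd w.1 w.2
      have hΦχ : Φ w.1 w.2 ≤ χ w := by
        rw [hχ]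
        by_cases hgt : ϰ * k < Φ w.1 w.2
        · have hwE : w ∈ E := by rw [hE]; exact ⟨⟨hwQ, hwS⟩, hgt⟩
          have := hup w hwt hwx hwS
          show Φ w.1 w.2 ≤ M * k * E.indicator (fun _ => (1 : ℝ)) w + ϰ * k
          rw [indicator_of_mem hwE, mul_one]
          linarith [mul_pos hϰ0 hk]
        · have h0 : 0 ≤ M * k * E.indicator (fun _ => (1 : ℝ)) w := mul_nonneg hMk (indicator_nonneg (fun _ _ => zero_le_one) _)
          show Φ w.1 w.2 ≤ M * k * E.indicator (fun _ => (1 : ℝ)) w + ϰ * k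
          linarith [not_lt.1 hgt]
      have e : 2 / cylRadius w.2 * ‖fderiv ℝ (η₀ w.1) w.2‖ = 2 * (cylRadius w.2)⁻¹ * ‖fderiv ℝ (η₀ w.1) w.2‖ := by
        rw [div_eq_mul_inv]
      rw [indicator_of_mem hwQ, e, hF]
      exact pointwise_majorant hΦ0 hΦχ (norm_nonneg _) (inv_nonneg.2 (cylRadius_nonneg _)) (abs_nonneg _)
        (norm_nonneg _) (abs_nonneg _) h1 h2 h3
    · rw [timeDeriv_slice_eq_zero_of_notMem hw, fderiv_slice_eq_zero_of_notMem hw, laplacian_slice_eq_zero_of_notMem hw]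
      simp only [abs_zero, norm_zero, mul_zero, add_zero]
      exact indicator_nonneg (fun w _ => mul_nonneg (hχ0 w) (hF0 w)) _
  /- ── integrate: `(3π/16) kR³ ≤ ∫ Φ w₀ ≤ ∫_{Q'} χF = Mk ∫_E F + ϰk ∫_{Q'} F` ── -/
  have hgI : Integrable (Q'.indicator fun w => χ w * F w) := (integrable_indicator_iff hQ'm).2 hgi
  have hup1 : (∫ w : ℝ × EuclideanSpace ℝ (Fin 3), Φ w.1 w.2 * (|deriv (fun s => η₀ s w.2) w.1| +
      ‖U w.1 w.2‖ * ‖fderiv ℝ (η₀ w.1) w.2‖ + 2 / cylRadius w.2 * ‖fderiv ℝ (η₀ w.1) w.2‖ + |(Δ (η₀ w.1)) w.2|)) ≤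
      ∫ w in Q', χ w * F w := by
    have h := integral_mono_ae hint hgI hpt
    rwa [integral_indicator hQ'm] at h
  have hsplitχ : ∀ w, χ w * F w = M * k * E.indicator F w + ϰ * k * F w := by
    intro w; rw [hχ]; beta_reduce
    by_cases hw : w ∈ E
    · rw [indicator_of_mem hw, indicator_of_mem hw]; ring
    · rw [indicator_of_notMem hw, indicator_of_notMem hw]; ring
  have e1 : ∫ w in Q', χ w * F w = M * k * (∫ w in E, F w) + ϰ * k * ∫ w in Q', F w := by
    have i1 : IntegrableOn (fun w => M * k * E.indicator F w) Q' := (hFi.indicator hEm).const_mul _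
    have i2 : IntegrableOn (fun w => ϰ * k * F w) Q' := hFi.const_mul _
    rw [integral_congr_ae (Eventually.of_forall hsplitχ), integral_add i1 i2, integral_const_mul, integral_const_mul,
      setIntegral_indicator hEm, inter_eq_right.2 hEQ]
  have hFE : ∫ w in E, F w = 2 * C₀ / R ^ 2 * volume.real E + C₀ / R * (∫ w in E, ‖U w.1 w.2‖) +
      2 * C₀ / R * ∫ w in E, (cylRadius w.2)⁻¹ := by
    rw [hF]; exact setIntegral_affine_majorant hEfin (hU1Q.mono_set hEQ) (hρQ.mono_set hEQ) _ _ _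
  have hFQ : ∫ w in Q', F w = 2 * C₀ / R ^ 2 * volume.real Q' + C₀ / R * (∫ w in Q', ‖U w.1 w.2‖) +
      2 * C₀ / R * ∫ w in Q', (cylRadius w.2)⁻¹ := by
    rw [hF]; exact setIntegral_affine_majorant hQ'fin hU1Q hρQ _ _ _
  have hchain : 3 * Real.pi / 16 * (k * R ^ 3) ≤ M * k * (∫ w in E, F w) + ϰ * k * ∫ w in Q', F w := by
    linarith [hup1, e1.le]
  rw [hFE, hFQ, ← hV] at hchain
  /- ── the truncation bounds and the bookkeeping ── -/
  have hΛ : (∫ w in Q', ‖U w.1 w.2‖ ^ 3) ≤ cN * R ^ 2 := by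
    rw [hcN, hQ']; rw [hQ'] at hUmQ; exact setIntegral_norm_cube_slab_le hR hUmQ hN
  have hUE := setIntegral_norm_le_of_cube hEQ hEfin hU3Q (L := ℓ / R) (div_pos hℓ0 hR)
  have hUQ := setIntegral_norm_le_of_cube (subset_refl Q') hQ'fin hU3Q (L := R⁻¹) (inv_pos.2 hR)
  rw [← hV] at hUE
  have hthin : ∀ θ' : ℝ, 0 < θ' → (∫ w in Q' ∩ {w | cylRadius w.2 < θ' ^ 2 * R}, (cylRadius w.2)⁻¹) ≤
      R ^ 2 / 4 * ((C32 : ℝ) * θ' * R ^ 2) := fun θ' hθ' => by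
    have h := slabIntegral_inv_cylRadius_thin_le hC32 hR (a := -R ^ 2) (b := -(3 / 4) * R ^ 2)
      (by linarith [pow_pos hR 2]) hθ'
    rw [← hQ', show -(3 / 4) * R ^ 2 - -R ^ 2 = R ^ 2 / 4 by ring] at h
    exact h
  have hρE := setIntegral_inv_cylRadius_le hQ'm hEm hEQ hEfin hρQ (ρ := θ ^ 2 * R) (mul_pos (pow_pos hθ0 2) hR)
  have hρQ' := setIntegral_inv_cylRadius_le hQ'm hQ'm (subset_refl Q') hQ'fin hρQ (ρ := 1 ^ 2 * R)
    (by rw [one_pow, one_mul]; exact hR)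
  rw [← hV] at hρE
  have hVlow : δ * R ^ 5 ≤ V :=
    axis_measure_algebra hM hMM' hC₀0 (NNReal.coe_nonneg C32) (by rw [hcN]; positivity) hℓ0 hθ0 hϰ0 hk hR hV0 hvolQ'r
      hΓ hδ hP1 hP2 hP3 hD' hΛ hUE hUQ (hthin θ hθ0) (hthin 1 one_pos) hρE hρQ' hchain
  /- ── from `V = |E|` to the target superlevel set ── -/
  have hEsub : E ⊆ {w : ℝ × EuclideanSpace ℝ (Fin 3) |
      w ∈ Icc (-R ^ 2) (-(3 / 4) * R ^ 2) ×ˢ ball (0 : EuclideanSpace ℝ (Fin 3)) R ∧ ϰ * k < Φ w.1 w.2} := fun w hw => by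
    rw [hE, hQ'] at hw
    have h1 := mem_prod.1 hw.1.1
    exact ⟨⟨Ioo_subset_Icc_self h1.1, h1.2⟩, hw.2⟩
  calc ENNReal.ofReal (δ * R ^ 5) ≤ ENNReal.ofReal V := ENNReal.ofReal_le_ofReal hVlow
    _ = volume E := by rw [hV, measureReal_def, ENNReal.ofReal_toReal hEfin.ne]
    _ ≤ _ := measure_mono hEsub

end Summit.NavierStokesRegularity.NavierStokesRegularity.Theorems.AxisymmetricKatoGlobal.EulerScaling

end
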